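import Summits.AtomisticToContinuum.Crystallization.Theorems.ChargedEnergyGapChartDialQ

/-!
# `ChargedEnergyGap` · the CHART DIAL, part R: THE BOND-GRAPH SPLIT IS LOSSLESS
(decomp-a2c lens-3 g39 node «ChargeFreeGap»; certificate that part Q's split of the feeder of hypothesis 3 is an
EQUIVALENCE at the dial of record `θ ≤ 3/20`)

Part Q split the finite shape statement `TwelveShellShaped θ` (over scale-free dozens `(t, b)`, part P) along the bond
graph `b` into [G] `DozenBondGraphs`, [A] `NoAntiprismDozen` and [C] `GraphedDozenClose` (sufficient:
`twelveShellShaped_of_bondGraphs`).  This part proves the CONVERSE, for `θ ≤ 3/20`: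

* §1–§3 ([G] is necessary).  `tupleIso_of_tupleClose` — a scale-free dozen that is `θ`-tuple-close to a tuple `p`
  enumerating a kissing pattern HAS the bond graph of `p`: the relabelling of the closeness matching carries the
  unit-distance graph of `p` exactly onto `b`.  [A bonded pair is `≤ 1·01²` apart ((R1), (R4)), so its matched
  pattern vectors are `< 2θ + 1·0201 < √2` apart, hence at distance EXACTLY `1` (`dist_eq_one_of_near`: distinct
  kissing-pattern vectors closer than `√2` are adjacent — the integer models of part L, `decide`); conversely the
  four bond neighbours of a point ((count)) are matched injectively into the at most four pattern vectors within
  `√2` of its own match (part L, `ncard_near_le_four`), so they exhaust them — the tuple version of part N's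
  `adj_of_matched_near`.]  Hence `twelveShellShaped_graph_and_close` (under `TwelveShellShaped θ` every scale-free
  dozen is `θ`-close to `pf` AND `pf`-graphed, or `θ`-close to `ph` AND `ph`-graphed) and
  `dozenBondGraphs_of_twelveShellShaped`.
* §4–§7 ([A], [C] are necessary).  The three candidate bond graphs are pairwise non-isomorphic by one elementary
  invariant of a vertex LINK (the graph induced on the four bond neighbours of a vertex): cuboctahedron — no link
  contains a 2-path `y₁ ∼ y₂ ∼ y₃`, `y₁ ≠ y₃` (every link is two disjoint edges; `fccInt_no_linkPath2`, `decide`);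
  anticuboctahedron — some link contains a 2-path (the `T,T,Q,Q` vertices; explicit witness) but none a 3-path
  (`hcpInt_no_linkPath3`, `decide`); hexagonal antiprism — the link of `0` contains the 3-path `1 ∼ 6 ∼ 11 ∼ 5`.
  Transported along `TupleIso` / `AntiprismIso` through the integer model of a pattern tuple (`exists_intModel`,
  `dist_eq_one_iff_sqNormInt`): `not_tupleIso_fcc_hcp`, `not_antiprismIso_of_tupleIso`, whence
  `noAntiprismDozen_of_twelveShellShaped`, `graphedDozenClose_fcc_of_twelveShellShaped`,
  `graphedDozenClose_hcp_of_twelveShellShaped`.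
* §8 ★ `twelveShellShaped_iff_bondGraphPieces (hθ : θ ≤ 3/20) :
  TwelveShellShaped θ ↔ DozenBondGraphs pf ph ∧ NoAntiprismDozen ∧ GraphedDozenClose θ pf ∧ GraphedDozenClose θ ph`.

Consequence for the census bookkeeping: at `θ = 3/20` a refutation of ANY piece of part Q (a certified exotic
scale-free dozen = I-GRAPH kill; an antiprism dozen; a pattern-graphed dozen farther than `3/20` from its pattern)
refutes the feeder `TwelveShellShaped (3/20)` (part O) itself — by theorem.

No `sorry`, no new axiom, no new definition, no instance / notation / option.
-/

noncomputable section

open Literature.MathematicalPhysics.StatisticalMechanics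
open Literature.Geometry.DiscreteGeometry
open Literature.Geometry.DiscreteGeometry.ShellCensus
open Summit.AtomisticToContinuum.Crystallization.Theses.PricedLinkCensus
open Summit.AtomisticToContinuum.Crystallization.Theorems.ChargedEnergyGapNegative

namespace Summit.AtomisticToContinuum.Crystallization.Theorems.ChargedEnergyGapChartDial

/-! ## §1 Distinct kissing-pattern vectors closer than `√2` are at distance exactly `1` -/

/-- FCC, integer model: squared integer distance `< 4` between distinct cuboctahedron vertices is `2`. -/
theorem sqNormInt_near_fccInt : ∀ v₀ ∈ fccInt, ∀ v ∈ fccInt, v ≠ v₀ →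
    sqNormInt (v₀ - v) < 2 * ((2 : ℕ) : ℤ) → sqNormInt (v₀ - v) = ((2 : ℕ) : ℤ) := by
  decide

/-- HCP, integer model: squared integer distance `< 36` between distinct anticuboctahedron vertices is `18`. -/
theorem sqNormInt_near_hcpInt : ∀ v₀ ∈ hcpInt, ∀ v ∈ hcpInt, v ≠ v₀ →
    sqNormInt (v₀ - v) < 2 * ((18 : ℕ) : ℤ) → sqNormInt (v₀ - v) = ((18 : ℕ) : ℤ) := by
  decide

/-- Transport from the integer model to a rotated scaled pattern. -/
theorem dist_eq_one_of_near_int {S : Finset (Fin 3 → ℤ)} {N : ℕ} (hN : N ≠ 0)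
    (hS : ∀ v₀ ∈ S, ∀ v ∈ S, v ≠ v₀ → sqNormInt (v₀ - v) < 2 * (N : ℤ) → sqNormInt (v₀ - v) = (N : ℤ))
    (A : E3 →ₗᵢ[ℝ] E3) {y₀ y : E3} (hy₀ : y₀ ∈ (scaledPattern S N).image A) (hy : y ∈ (scaledPattern S N).image A)
    (hne : y ≠ y₀) (hd : dist y₀ y < Real.sqrt 2) : dist y₀ y = 1 := by
  obtain ⟨x₀, hx₀, rfl⟩ := Finset.mem_image.1 hy₀
  obtain ⟨v₀, hv₀, rfl⟩ := Finset.mem_image.1 hx₀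
  obtain ⟨x, hx, rfl⟩ := Finset.mem_image.1 hy
  obtain ⟨v, hv, rfl⟩ := Finset.mem_image.1 hx
  rw [A.isometry.dist_eq] at hd ⊢
  have hvne : v ≠ v₀ := by rintro rfl; exact hne rfl
  exact dist_scaled_eq_one hN (hS v₀ hv₀ v hv hvne (sqNormInt_lt_of_dist_lt hN hd))

/-- **Pattern distance dichotomy** (both kissing patterns, rotated): two distinct pattern vectors at distance `< √2`
are at distance exactly `1`. -/
theorem dist_eq_one_of_near {P : Finset E3} (hP : P = fccKissingPattern ∨ P = hcpKissingPattern)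
    (A : E3 →ₗᵢ[ℝ] E3) {y₀ y : E3} (hy₀ : y₀ ∈ P.image A) (hy : y ∈ P.image A) (hne : y ≠ y₀)
    (hd : dist y₀ y < Real.sqrt 2) : dist y₀ y = 1 := by
  rcases hP with rfl | rfl
  · exact dist_eq_one_of_near_int (by norm_num) sqNormInt_near_fccInt A hy₀ hy hne hd
  · exact dist_eq_one_of_near_int (by norm_num) sqNormInt_near_hcpInt A hy₀ hy hne hd

/-! ## §2 Closeness forces the bond graph -/

/-- A tuple enumerating a kissing pattern is injective. -/
theorem injective_of_image_eq_pattern {P : Finset E3} (hP : P = fccKissingPattern ∨ P = hcpKissingPattern)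
    {p : Fin 12 → E3} (hp : Finset.univ.image p = P) : Function.Injective p := by
  classical
  have hPcard : P.card = 12 := by
    rcases hP with rfl | rfl
    exacts [card_fccKissingPattern, card_hcpKissingPattern]
  have hc : (Finset.univ.image p).card = (Finset.univ : Finset (Fin 12)).card := by
    rw [hp, hPcard, Finset.card_univ, Fintype.card_fin]
  have hinj : Set.InjOn p ↑(Finset.univ : Finset (Fin 12)) := Finset.card_image_iff.1 hc
  exact fun a c h => hinj (Finset.mem_coe.2 (Finset.mem_univ a)) (Finset.mem_coe.2 (Finset.mem_univ c)) h

/-- **CLOSENESS FORCES THE BOND GRAPH** (`θ ≤ 3/20`): a scale-free dozen `θ`-tuple-close to a tuple `p` enumerating a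
kissing pattern has, up to the relabelling of the matching, exactly the unit-distance graph of `p` as bond graph. -/
theorem tupleIso_of_tupleClose {θ : ℝ} (hθ : θ ≤ 3 / 20) {P : Finset E3}
    (hP : P = fccKissingPattern ∨ P = hcpKissingPattern) {p : Fin 12 → E3} (hp : Finset.univ.image p = P)
    {t : Fin 12 → E3} {b : Fin 12 → Fin 12 → Prop} (hD : IsScaleFreeDozen t b) {A : E3 →ₗᵢ[ℝ] E3}
    {σ : Equiv.Perm (Fin 12)} (hσ : ∀ k, dist (t k) (A (p (σ k))) ≤ θ) : TupleIso b σ.symm p := by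
  classical
  have hs : (13201 / 10000 : ℝ) < Real.sqrt 2 := by
    rw [Real.lt_sqrt (by norm_num)]; norm_num
  obtain ⟨h1, -, -, hirr, hcount, h4, -⟩ := hD
  have hpinj : Function.Injective p := injective_of_image_eq_pattern hP hp
  -- the matching `m k := A (p (σ k))`
  set m : Fin 12 → E3 := fun k => A (p (σ k)) with hm
  have hmP : ∀ k, m k ∈ P.image A := fun k =>
    Finset.mem_image.2 ⟨p (σ k), by rw [← hp]; exact Finset.mem_image_of_mem _ (Finset.mem_univ _), rfl⟩
  have hminj : Function.Injective m := fun k l h => σ.injective (hpinj (A.injective h))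
  have hmd : ∀ k, dist (t k) (m k) ≤ θ := hσ
  -- bonded pairs are matched to pattern vectors `< √2` apart, hence EXACTLY `1` apart
  have hnear : ∀ k l, b k l → dist (m k) (m l) < Real.sqrt 2 := by
    intro k l hkl
    calc dist (m k) (m l) ≤ dist (m k) (t k) + dist (t k) (t l) + dist (t l) (m l) := dist_triangle4 _ _ _ _
      _ ≤ θ + 101 / 100 * (101 / 100) + θ := by
          gcongr
          · rw [dist_comm]; exact hmd k
          · exact ((h4 k l hkl).1).trans (by have := (h1 k).2; nlinarith)
          · exact hmd l
      _ < Real.sqrt 2 := by linarith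
  have hone : ∀ k l, b k l → dist (m k) (m l) = 1 := by
    intro k l hkl
    refine dist_eq_one_of_near hP A (hmP k) (hmP l) (fun h => ?_) (hnear k l hkl)
    have hlk : l = k := hminj h
    rw [hlk] at hkl
    exact hirr k hkl
  have hmu : ∀ u, m (σ.symm u) = A (p u) := fun u => by simp [hm]
  intro v w hvw
  have hdist : dist (p v) (p w) = dist (m (σ.symm v)) (m (σ.symm w)) := by
    rw [hmu, hmu, A.isometry.dist_eq]
  refine ⟨fun hb => by rw [hdist]; exact hone _ _ hb, fun hd1 => ?_⟩
  -- a pattern neighbour is the match of a bond neighbour (counting)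
  set k := σ.symm v with hk
  set l := σ.symm w with hl
  have hkl' : k ≠ l := fun h => hvw (σ.symm.injective h)
  by_contra hkl
  set U : Set (Fin 12) := {j | b k j} with hU
  have hU4 : U.ncard = 4 := hcount k
  set W : Set E3 := {y | y ∈ P.image A ∧ y ≠ m k ∧ dist (m k) y < Real.sqrt 2} with hW
  have hW4 : W.ncard ≤ 4 := ncard_near_le_four hP A (hmP k)
  have hWfin : W.Finite := (P.image A).finite_toSet.subset fun y hy => hy.1
  have hsub : m '' U ⊆ W := by
    rintro _ ⟨j, hj, rfl⟩
    refine ⟨hmP j, fun h => ?_, hnear k j hj⟩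
    have hjk : j = k := hminj h
    rw [hjk] at hj
    exact hirr k hj
  have hcardU : (m '' U).ncard = 4 := by rw [Set.ncard_image_of_injective _ hminj, hU4]
  have heq : m '' U = W := Set.eq_of_subset_of_ncard_le hsub (by rw [hcardU]; exact hW4) hWfin
  have hlW : m l ∈ W := by
    refine ⟨hmP l, fun h => hkl' (hminj h).symm, ?_⟩
    rw [← hdist, hd1]
    linarith
  rw [← heq] at hlW
  obtain ⟨j, hj, hje⟩ := hlW
  exact hkl (by rw [← hminj hje]; exact hj)

/-- Existential form. -/
theorem exists_tupleIso_of_tupleClose {θ : ℝ} (hθ : θ ≤ 3 / 20) {P : Finset E3}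
    (hP : P = fccKissingPattern ∨ P = hcpKissingPattern) {p : Fin 12 → E3} (hp : Finset.univ.image p = P)
    {t : Fin 12 → E3} {b : Fin 12 → Fin 12 → Prop} (hD : IsScaleFreeDozen t b) (hc : TupleClose θ t p) :
    ∃ σ : Equiv.Perm (Fin 12), TupleIso b σ p := by
  obtain ⟨A, σ, hσ⟩ := hc
  exact ⟨σ.symm, tupleIso_of_tupleClose hθ hP hp hD hσ⟩

/-! ## §3 [G] is necessary -/

/-- **Graph AND closeness come together** under the finite shape statement (`θ ≤ 3/20`). -/
theorem twelveShellShaped_graph_and_close {θ : ℝ} (hθ : θ ≤ 3 / 20) {pf ph : Fin 12 → E3}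
    (hpf : Finset.univ.image pf = fccKissingPattern) (hph : Finset.univ.image ph = hcpKissingPattern)
    (h : TwelveShellShaped θ) {t : Fin 12 → E3} {b : Fin 12 → Fin 12 → Prop} (hD : IsScaleFreeDozen t b) :
    (TupleClose θ t pf ∧ ∃ σ : Equiv.Perm (Fin 12), TupleIso b σ pf) ∨
      (TupleClose θ t ph ∧ ∃ σ : Equiv.Perm (Fin 12), TupleIso b σ ph) := by
  rw [twelveShellShaped_iff_isScaleFreeDozen hpf hph] at h
  rcases h t b hD with hc | hc
  · exact Or.inl ⟨hc, exists_tupleIso_of_tupleClose hθ (Or.inl rfl) hpf hD hc⟩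
  · exact Or.inr ⟨hc, exists_tupleIso_of_tupleClose hθ (Or.inr rfl) hph hD hc⟩

/-- **[G] IS NECESSARY**: `TwelveShellShaped θ → DozenBondGraphs pf ph` for `θ ≤ 3/20` (no antiprism disjunct
needed). -/
theorem dozenBondGraphs_of_twelveShellShaped {θ : ℝ} (hθ : θ ≤ 3 / 20) {pf ph : Fin 12 → E3}
    (hpf : Finset.univ.image pf = fccKissingPattern) (hph : Finset.univ.image ph = hcpKissingPattern)
    (h : TwelveShellShaped θ) : DozenBondGraphs pf ph := by
  intro t b hD
  rcases twelveShellShaped_graph_and_close hθ hpf hph h hD with ⟨-, σ, hσ⟩ | ⟨-, σ, hσ⟩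
  · exact ⟨σ, Or.inl hσ⟩
  · exact ⟨σ, Or.inr (Or.inl hσ)⟩

/-! ## §4 Link invariants of the integer models (kernel decision) -/

/-- FCC integer model: no vertex link of the cuboctahedron graph contains a 2-path. -/
theorem fccInt_no_linkPath2 : ∀ v₀ ∈ fccInt, ∀ n₁ ∈ fccInt, sqNormInt (v₀ - n₁) = ((2 : ℕ) : ℤ) →
    ∀ n₂ ∈ fccInt, sqNormInt (v₀ - n₂) = ((2 : ℕ) : ℤ) → sqNormInt (n₁ - n₂) = ((2 : ℕ) : ℤ) →
    ∀ n₃ ∈ fccInt, sqNormInt (v₀ - n₃) = ((2 : ℕ) : ℤ) → sqNormInt (n₂ - n₃) = ((2 : ℕ) : ℤ) → n₁ ≠ n₃ →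
    False := by
  decide

/-- HCP integer model: no vertex link of the anticuboctahedron graph contains a 3-path. -/
theorem hcpInt_no_linkPath3 : ∀ v₀ ∈ hcpInt, ∀ n₁ ∈ hcpInt, sqNormInt (v₀ - n₁) = ((18 : ℕ) : ℤ) →
    ∀ n₂ ∈ hcpInt, sqNormInt (v₀ - n₂) = ((18 : ℕ) : ℤ) → sqNormInt (n₁ - n₂) = ((18 : ℕ) : ℤ) →
    ∀ n₃ ∈ hcpInt, sqNormInt (v₀ - n₃) = ((18 : ℕ) : ℤ) → sqNormInt (n₂ - n₃) = ((18 : ℕ) : ℤ) → n₁ ≠ n₃ →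
    ∀ n₄ ∈ hcpInt, sqNormInt (v₀ - n₄) = ((18 : ℕ) : ℤ) → sqNormInt (n₃ - n₄) = ((18 : ℕ) : ℤ) → n₂ ≠ n₄ →
    False := by
  decide

/-! ## §5 The integer model of a pattern tuple -/

/-- A tuple enumerating a scaled integer pattern, read in the integer model: `p v = (g v)/√N` with `g` onto `S`. -/
theorem exists_intModel {S : Finset (Fin 3 → ℤ)} {N : ℕ} (hN : N ≠ 0) {p : Fin 12 → E3}
    (hp : Finset.univ.image p = scaledPattern S N) :
    ∃ g : Fin 12 → (Fin 3 → ℤ), (∀ v, g v ∈ S) ∧ (∀ v, p v = (Real.sqrt N)⁻¹ • intVec (g v)) ∧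
      ∀ s ∈ S, ∃ v, g v = s := by
  classical
  have hmem : ∀ v, p v ∈ scaledPattern S N := fun v => by
    rw [← hp]; exact Finset.mem_image_of_mem _ (Finset.mem_univ _)
  have hex : ∀ v, ∃ s ∈ S, ((Real.sqrt N)⁻¹ • intVec s : E3) = p v := fun v => Finset.mem_image.1 (hmem v)
  choose g hgS hgp using hex
  refine ⟨g, hgS, fun v => (hgp v).symm, fun s hs => ?_⟩
  have hs' : ((Real.sqrt N)⁻¹ • intVec s : E3) ∈ Finset.univ.image p := by
    rw [hp]; exact Finset.mem_image_of_mem _ hs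
  obtain ⟨v, -, hv⟩ := Finset.mem_image.1 hs'
  have h2 : ((Real.sqrt N)⁻¹ • intVec (g v) : E3) = (Real.sqrt N)⁻¹ • intVec s := by rw [hgp v, hv]
  exact ⟨v, scaledPattern_map_injective hN h2⟩

/-- Pattern edges in the integer model: real distance `1` iff integer squared distance `N`. -/
theorem dist_eq_one_iff_sqNormInt {N : ℕ} (hN : N ≠ 0) (v w : Fin 3 → ℤ) :
    dist ((Real.sqrt N)⁻¹ • intVec v : E3) ((Real.sqrt N)⁻¹ • intVec w) = 1 ↔ sqNormInt (v - w) = (N : ℤ) := by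
  refine ⟨fun h => ?_, dist_scaled_eq_one hN⟩
  rw [dist_scaled_intVec hN] at h
  have hpos : (0 : ℝ) < Real.sqrt N := by positivity
  have h1 : Real.sqrt N = Real.sqrt (sqNormInt (v - w) : ℝ) := (inv_mul_eq_one₀ hpos.ne').1 h
  have h0 : (0 : ℝ) ≤ (sqNormInt (v - w) : ℝ) := by
    have : (0 : ℤ) ≤ sqNormInt (v - w) := by unfold sqNormInt; positivity
    exact_mod_cast this
  have h2 : (N : ℝ) = (sqNormInt (v - w) : ℝ) := (Real.sqrt_inj (Nat.cast_nonneg N) h0).1 h1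
  exact_mod_cast h2.symm

/-- Squared integer distance `N ≠ 0` forces distinct labels. -/
theorem ne_of_sqNormInt_eq {N : ℕ} (hN : N ≠ 0) {g : Fin 12 → (Fin 3 → ℤ)} {v w : Fin 12}
    (h : sqNormInt (g v - g w) = (N : ℤ)) : v ≠ w := by
  rintro rfl
  simp [sqNormInt] at h
  exact hN (by exact_mod_cast h.symm)

/-! ## §6 Transport of link paths along the graph identifications -/

section transport

variable {b : Fin 12 → Fin 12 → Prop}

/-- Along `TupleIso b σ p`, a bond reads as a pattern edge in the integer model. -/
theorem sqNormInt_of_bond {N : ℕ} (hN : N ≠ 0) {p : Fin 12 → E3}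
    {g : Fin 12 → (Fin 3 → ℤ)} (hgp : ∀ v, p v = (Real.sqrt N)⁻¹ • intVec (g v)) (hirr : ∀ i, ¬ b i i)
    {σ : Equiv.Perm (Fin 12)} (hI : TupleIso b σ p) {u u' : Fin 12} (hb : b u u') :
    sqNormInt (g (σ.symm u) - g (σ.symm u')) = (N : ℤ) := by
  have hne : u ≠ u' := by rintro rfl; exact hirr u hb
  have hne' : σ.symm u ≠ σ.symm u' := fun h => hne (σ.symm.injective h)
  have hb' : b (σ (σ.symm u)) (σ (σ.symm u')) := by simpa using hb
  have hd : dist (p (σ.symm u)) (p (σ.symm u')) = 1 := (hI _ _ hne').1 hb'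
  rw [hgp, hgp] at hd
  exact (dist_eq_one_iff_sqNormInt hN _ _).1 hd

/-- Along `TupleIso b σ p`, a pattern edge in the integer model reads as a bond. -/
theorem bond_of_sqNormInt {N : ℕ} (hN : N ≠ 0) {p : Fin 12 → E3}
    {g : Fin 12 → (Fin 3 → ℤ)} (hgp : ∀ v, p v = (Real.sqrt N)⁻¹ • intVec (g v))
    {σ : Equiv.Perm (Fin 12)} (hI : TupleIso b σ p) {v w : Fin 12} (h : sqNormInt (g v - g w) = (N : ℤ)) :
    b (σ v) (σ w) :=
  (hI v w (ne_of_sqNormInt_eq hN h)).2 (by rw [hgp, hgp]; exact dist_scaled_eq_one hN h)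

/-- **Cuboctahedron-graphed bond relations have no 2-path in a link.** -/
theorem no_linkPath2_of_tupleIso_fcc {pf : Fin 12 → E3} (hpf : Finset.univ.image pf = fccKissingPattern)
    (hirr : ∀ i, ¬ b i i) {σ : Equiv.Perm (Fin 12)} (hI : TupleIso b σ pf) {x y₁ y₂ y₃ : Fin 12}
    (h₁ : b x y₁) (h₂ : b x y₂) (h₃ : b x y₃) (h₁₂ : b y₁ y₂) (h₂₃ : b y₂ y₃) (hne : y₁ ≠ y₃) : False := by
  classical
  obtain ⟨g, hgS, hgp, -⟩ := exists_intModel (S := fccInt) (N := 2) two_ne_zero hpf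
  have hpinj : Function.Injective pf := injective_of_image_eq_pattern (Or.inl rfl) hpf
  have key : ∀ {u u' : Fin 12}, b u u' → sqNormInt (g (σ.symm u) - g (σ.symm u')) = ((2 : ℕ) : ℤ) :=
    fun hb => sqNormInt_of_bond two_ne_zero hgp hirr hI hb
  have hgne : g (σ.symm y₁) ≠ g (σ.symm y₃) := by
    intro h
    apply hne
    have h' : pf (σ.symm y₁) = pf (σ.symm y₃) := by rw [hgp, hgp, h]
    exact σ.symm.injective (hpinj h')
  exact fccInt_no_linkPath2 _ (hgS _) _ (hgS _) (key h₁) _ (hgS _) (key h₂) (key h₁₂) _ (hgS _) (key h₃)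
    (key h₂₃) hgne

/-- **Anticuboctahedron-graphed bond relations have no 3-path in a link.** -/
theorem no_linkPath3_of_tupleIso_hcp {ph : Fin 12 → E3} (hph : Finset.univ.image ph = hcpKissingPattern)
    (hirr : ∀ i, ¬ b i i) {σ : Equiv.Perm (Fin 12)} (hI : TupleIso b σ ph) {x y₁ y₂ y₃ y₄ : Fin 12}
    (h₁ : b x y₁) (h₂ : b x y₂) (h₃ : b x y₃) (h₄ : b x y₄) (h₁₂ : b y₁ y₂) (h₂₃ : b y₂ y₃) (h₃₄ : b y₃ y₄)
    (hne : y₁ ≠ y₃) (hne' : y₂ ≠ y₄) : False := by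
  classical
  obtain ⟨g, hgS, hgp, -⟩ := exists_intModel (S := hcpInt) (N := 18) (by norm_num) hph
  have hpinj : Function.Injective ph := injective_of_image_eq_pattern (Or.inr rfl) hph
  have key : ∀ {u u' : Fin 12}, b u u' → sqNormInt (g (σ.symm u) - g (σ.symm u')) = ((18 : ℕ) : ℤ) :=
    fun hb => sqNormInt_of_bond (by norm_num) hgp hirr hI hb
  have hgne : ∀ {u u' : Fin 12}, u ≠ u' → g (σ.symm u) ≠ g (σ.symm u') := by
    intro u u' hu h
    apply hu
    have h' : ph (σ.symm u) = ph (σ.symm u') := by rw [hgp, hgp, h]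
    exact σ.symm.injective (hpinj h')
  exact hcpInt_no_linkPath3 _ (hgS _) _ (hgS _) (key h₁) _ (hgS _) (key h₂) (key h₁₂) _ (hgS _) (key h₃)
    (key h₂₃) (hgne hne) _ (hgS _) (key h₄) (key h₃₄) (hgne hne')
/-- **Anticuboctahedron-graphed bond relations HAVE a 2-path in a link** (at a vertex of type `T,T,Q,Q`). -/
theorem linkPath2_of_tupleIso_hcp {ph : Fin 12 → E3} (hph : Finset.univ.image ph = hcpKissingPattern)
    {σ : Equiv.Perm (Fin 12)} (hI : TupleIso b σ ph) :
    ∃ x y₁ y₂ y₃ : Fin 12, b x y₁ ∧ b x y₂ ∧ b x y₃ ∧ b y₁ y₂ ∧ b y₂ y₃ ∧ y₁ ≠ y₃ := by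
  classical
  obtain ⟨g, -, hgp, hsurj⟩ := exists_intModel (S := hcpInt) (N := 18) (by norm_num) hph
  obtain ⟨v₀, hv₀⟩ := hsurj ![3, -3, 0] (by decide)
  obtain ⟨v₁, hv₁⟩ := hsurj ![3, 0, 3] (by decide)
  obtain ⟨v₂, hv₂⟩ := hsurj ![0, -3, 3] (by decide)
  obtain ⟨v₃, hv₃⟩ := hsurj ![-1, -4, -1] (by decide)
  have adj : ∀ {v w : Fin 12}, sqNormInt (g v - g w) = ((18 : ℕ) : ℤ) → b (σ v) (σ w) :=
    fun h => bond_of_sqNormInt (by norm_num) hgp hI h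
  refine ⟨σ v₀, σ v₁, σ v₂, σ v₃, adj ?_, adj ?_, adj ?_, adj ?_, adj ?_, ?_⟩
  · rw [hv₀, hv₁]; decide
  · rw [hv₀, hv₂]; decide
  · rw [hv₀, hv₃]; decide
  · rw [hv₁, hv₂]; decide
  · rw [hv₂, hv₃]; decide
  · intro h
    have h' : g v₁ = g v₃ := by rw [σ.injective h]
    rw [hv₁, hv₃] at h'
    exact absurd h' (by decide)
/-- **Antiprism-graphed bond relations have a 3-path in a link** (`1 ∼ 6 ∼ 11 ∼ 5` around `0`). -/
theorem linkPath3_of_antiprismIso {σ : Equiv.Perm (Fin 12)} (hA : AntiprismIso b σ) :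
    ∃ x y₁ y₂ y₃ y₄ : Fin 12, b x y₁ ∧ b x y₂ ∧ b x y₃ ∧ b x y₄ ∧ b y₁ y₂ ∧ b y₂ y₃ ∧ b y₃ y₄ ∧
      y₁ ≠ y₃ ∧ y₂ ≠ y₄ := by
  refine ⟨σ 0, σ 1, σ 6, σ 11, σ 5, (hA 0 1 (by decide)).2 (by decide), (hA 0 6 (by decide)).2 (by decide),
    (hA 0 11 (by decide)).2 (by decide), (hA 0 5 (by decide)).2 (by decide), (hA 1 6 (by decide)).2 (by decide),
    (hA 6 11 (by decide)).2 (by decide), (hA 11 5 (by decide)).2 (by decide),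
    fun h => absurd (σ.injective h) (by decide), fun h => absurd (σ.injective h) (by decide)⟩
end transport

/-! ## §7 Non-isomorphism of the three bond-graph types -/
/-- No (irreflexive) bond relation is both cuboctahedron- and anticuboctahedron-graphed. -/
theorem not_tupleIso_fcc_hcp {pf ph : Fin 12 → E3} (hpf : Finset.univ.image pf = fccKissingPattern)
    (hph : Finset.univ.image ph = hcpKissingPattern) {b : Fin 12 → Fin 12 → Prop} (hirr : ∀ i, ¬ b i i)
    {σ π : Equiv.Perm (Fin 12)} (hf : TupleIso b σ pf) (hh : TupleIso b π ph) : False := by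
  obtain ⟨x, y₁, y₂, y₃, h₁, h₂, h₃, h₁₂, h₂₃, hne⟩ := linkPath2_of_tupleIso_hcp hph hh
  exact no_linkPath2_of_tupleIso_fcc hpf hirr hf h₁ h₂ h₃ h₁₂ h₂₃ hne
/-- A pattern-graphed (irreflexive) bond relation is not antiprism-graphed. -/
theorem not_antiprismIso_of_tupleIso {pf ph : Fin 12 → E3} (hpf : Finset.univ.image pf = fccKissingPattern)
    (hph : Finset.univ.image ph = hcpKissingPattern) {b : Fin 12 → Fin 12 → Prop} (hirr : ∀ i, ¬ b i i)
    {σ π : Equiv.Perm (Fin 12)} (hI : TupleIso b σ pf ∨ TupleIso b σ ph) (hA : AntiprismIso b π) : False := by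
  obtain ⟨x, y₁, y₂, y₃, y₄, h₁, h₂, h₃, h₄, h₁₂, h₂₃, h₃₄, hne, hne'⟩ := linkPath3_of_antiprismIso hA
  rcases hI with hI | hI
  · exact no_linkPath2_of_tupleIso_fcc hpf hirr hI h₁ h₂ h₃ h₁₂ h₂₃ hne
  · exact no_linkPath3_of_tupleIso_hcp hph hirr hI h₁ h₂ h₃ h₄ h₁₂ h₂₃ h₃₄ hne hne'

/-! ## §8 [A] and [C] are necessary; the split is an equivalence -/
/-- **[A] IS NECESSARY** (`θ ≤ 3/20`). -/
theorem noAntiprismDozen_of_twelveShellShaped {θ : ℝ} (hθ : θ ≤ 3 / 20) {pf ph : Fin 12 → E3}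
    (hpf : Finset.univ.image pf = fccKissingPattern) (hph : Finset.univ.image ph = hcpKissingPattern)
    (h : TwelveShellShaped θ) : NoAntiprismDozen := by
  intro t b hD π hA
  have hirr : ∀ i, ¬ b i i := hD.2.2.2.1
  obtain ⟨σ, hσ⟩ := dozenBondGraphs_of_twelveShellShaped hθ hpf hph h t b hD
  rcases hσ with hσ | hσ | hσ
  · exact not_antiprismIso_of_tupleIso hpf hph hirr (Or.inl hσ) hA
  · exact not_antiprismIso_of_tupleIso hpf hph hirr (Or.inr hσ) hA
  · -- the third disjunct does not occur (part R gives one of the first two), but is harmless: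
    obtain ⟨-, τ, hτ⟩ | ⟨-, τ, hτ⟩ := twelveShellShaped_graph_and_close hθ hpf hph h hD
    · exact not_antiprismIso_of_tupleIso hpf hph hirr (Or.inl hτ) hA
    · exact not_antiprismIso_of_tupleIso hpf hph hirr (Or.inr hτ) hA
/-- **[C] IS NECESSARY, cuboctahedral graph** (`θ ≤ 3/20`). -/
theorem graphedDozenClose_fcc_of_twelveShellShaped {θ : ℝ} (hθ : θ ≤ 3 / 20) {pf ph : Fin 12 → E3}
    (hpf : Finset.univ.image pf = fccKissingPattern) (hph : Finset.univ.image ph = hcpKissingPattern)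
    (h : TwelveShellShaped θ) : GraphedDozenClose θ pf := by
  intro t b hD σ hσ
  obtain ⟨hc, -⟩ | ⟨-, π, hπ⟩ := twelveShellShaped_graph_and_close hθ hpf hph h hD
  · exact hc
  · exact absurd (not_tupleIso_fcc_hcp hpf hph hD.2.2.2.1 hσ hπ) not_false
/-- **[C] IS NECESSARY, anticuboctahedral graph** (`θ ≤ 3/20`). -/
theorem graphedDozenClose_hcp_of_twelveShellShaped {θ : ℝ} (hθ : θ ≤ 3 / 20) {pf ph : Fin 12 → E3}
    (hpf : Finset.univ.image pf = fccKissingPattern) (hph : Finset.univ.image ph = hcpKissingPattern)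
    (h : TwelveShellShaped θ) : GraphedDozenClose θ ph := by
  intro t b hD σ hσ
  obtain ⟨-, π, hπ⟩ | ⟨hc, -⟩ := twelveShellShaped_graph_and_close hθ hpf hph h hD
  · exact absurd (not_tupleIso_fcc_hcp hpf hph hD.2.2.2.1 hπ hσ) not_false
  · exact hc
/-- ★ **THE BOND-GRAPH SPLIT IS LOSSLESS** (`θ ≤ 3/20`): part Q's pieces are jointly EQUIVALENT to the finite shape
statement. -/
theorem twelveShellShaped_iff_bondGraphPieces {θ : ℝ} (hθ : θ ≤ 3 / 20) {pf ph : Fin 12 → E3}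
    (hpf : Finset.univ.image pf = fccKissingPattern) (hph : Finset.univ.image ph = hcpKissingPattern) :
    TwelveShellShaped θ ↔
      DozenBondGraphs pf ph ∧ NoAntiprismDozen ∧ GraphedDozenClose θ pf ∧ GraphedDozenClose θ ph :=
  ⟨fun h => ⟨dozenBondGraphs_of_twelveShellShaped hθ hpf hph h, noAntiprismDozen_of_twelveShellShaped hθ hpf hph h,
      graphedDozenClose_fcc_of_twelveShellShaped hθ hpf hph h, graphedDozenClose_hcp_of_twelveShellShaped hθ hpf hph h⟩,
    fun h => twelveShellShaped_of_bondGraphs hpf hph h.1 h.2.1 h.2.2.1 h.2.2.2⟩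
end Summit.AtomisticToContinuum.Crystallization.Theorems.ChargedEnergyGapChartDial
end
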